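import Literature.NumberTheory.PAdicHodge.TiltOfPerfectResidue
import Literature.NumberTheory.PAdicHodge.FontaineThetaNaturality
import Literature.NumberTheory.PAdicHodge.FontaineThetaGalois
import Literature.NumberTheory.GaloisRepresentations.UnramifiedLang
import Literature.NumberTheory.GaloisRepresentations.PadicAlgebraOfLocalField
import HarnessLib

/-!
# `W(k̄) ⊆ 𝒪̂_{F^nr}` and the `Γ_F`-equivariant embedding `W(k̄) → 𝔸_inf(F)`

Let `F` be a non-archimedean local field of characteristic `0` and residue characteristic `p`
(`hp : valuation F p < 1`), `𝒪̂ = 𝒪̂_{F^nr} = maxUnramifiedCompletion F` the completed ring of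
integers of the maximal unramified extension (a complete discrete valuation ring; file
`UnramifiedCompletion`) and `k̄ = ResidueField 𝒪̂` its residue field (algebraically closed, of
characteristic `p`). This file constructs Fontaine's subring `W(k̄) = 𝒪_{F̂₀^nr}` of the period rings
(Fontaine 1994, Exp. II §1.2; Serre, *Local Fields* II §5 Thm. 4):

* `p` in `𝒪̂`: `p ∈ 𝔪̂`, `p ∉ 𝒪̂ˣ`, `𝔪̂ ^ e = (p)` for the absolute ramification index, and hence
  **`𝒪̂` is `p`-adically complete** (`isAdicComplete_span_natCast_completion`);
* `residueModP` : the reduction `𝒪̂/p → k̄`, a nil-thickening of bounded exponent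
  (`pow_nilExponent`), so that (file `TiltOfPerfectResidue`) **the tilt of `𝒪̂_{F^nr}` is `k̄`**:
  `residueTiltEquiv : k̄ ≃+* (𝒪̂_{F^nr})♭`;
* `wittToCompletion : 𝕎 k̄ →+* 𝒪̂_{F^nr}` — the embedding `W(k̄) ⊆ 𝒪̂_{F^nr}` of Serre II §5 Thm. 4
  (Fontaine's `θ` for `𝒪̂_{F^nr}`), reducing to the identity on residue fields
  (`residue_wittToCompletion`);
* `wittToAinf : 𝕎 k̄ →+* 𝔸_inf(F)` — **`W(k̄) → 𝔸_inf(F) = 𝕎(𝒪_{ℂ_F}♭)`**, Witt functoriality of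
  `k̄ ≃ (𝒪̂_{F^nr})♭ → 𝒪_{ℂ_F}♭` along the canonical `ι₀ : 𝒪̂_{F^nr} → 𝒪_{ℂ_F}` (`toCInt`), with
  **`θ ∘ wittToAinf = ι₀ ∘ wittToCompletion`** (`fontaineTheta_wittToAinf`, naturality of `θ`) and
  **`Γ_F`-equivariance** (`galAinf_wittToAinf`: `σ` acts on `𝕎 k̄` through its action on `k̄`,
  `residueGal σ`, induced by `galAut σ` on `𝒪̂_{F^nr}`).

These are the inputs for clause (F3) of `IsFontaineDatum` for `B_dR` (unramified representations
are `B`-admissible for every period ring `B ⊇ W(k̄)[1/p]`, Lang's theorem over `W(k̄)`) and for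
`P₀ = W(k̄)[1/p] ⊆ B_cris`.  The constructions take the residue-characteristic-`p` hypotheses as
instance arguments `Fact (¬ IsUnit (p : 𝒪̂))`, `CharP k̄ p` (discharged from `valuation F p < 1` by
`not_isUnit_natCast_completion`, `charP_residueField_completion`) and, where Fontaine's `θ` is
involved, `IsAdicComplete (p) 𝒪̂` (`isAdicComplete_span_natCast_completion`), as in
`FontaineThetaGalois`.

## References
* [FontaineAsterisque223III] J.-M. Fontaine, *Le corps des périodes p-adiques*, Astérisque 223
  (1994), Exp. II §1.2.
* [SerreLocalFields1979] J.-P. Serre, *Local Fields*, GTM 67, Ch. II §5 Thm. 4, Prop. 10.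
* [FontaineOuyang2022] J.-M. Fontaine, Y. Ouyang, *Theory of p-adic Galois representations*, §4.4.
-/

noncomputable section

open Ideal Perfection WittVector IsLocalRing ValuativeRel Field
open scoped ValuativeRel

namespace Literature.NumberTheory.PAdicHodge

open Literature.NumberTheory.GaloisRepresentations
open Literature.NumberTheory.GaloisRepresentations.IsNonarchimedeanLocalField

variable {F : Type} [Field F] [ValuativeRel F] [TopologicalSpace F] [IsNonarchimedeanLocalField F]
  {p : ℕ} [Fact p.Prime]

/-! ### The action of `Γ_F` on the residue field `k̄` -/

/-- `galAut σ` maps `𝔪̂` into `𝔪̂` (comap form). [folklore] -/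
theorem maximalIdeal_le_comap_galAut (σ : absoluteGaloisGroup F) :
    maximalIdeal (maxUnramifiedCompletion F) ≤
      (maximalIdeal (maxUnramifiedCompletion F)).comap (maxUnramifiedCompletion.galAut F σ).toRingHom :=
  fun _ hm => maxUnramifiedCompletion.galAut_mem_maximalIdeal σ hm

/-- **The action of `σ ∈ Γ_F` on `k̄`** induced by `galAut σ` on `𝒪̂_{F^nr}`. [cite: SerreLocalFields1979, Ch. II §5] -/
def residueGal (σ : absoluteGaloisGroup F) :
    ResidueField (maxUnramifiedCompletion F) →+* ResidueField (maxUnramifiedCompletion F) :=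
  Ideal.quotientMap (maximalIdeal (maxUnramifiedCompletion F)) (maxUnramifiedCompletion.galAut F σ).toRingHom
    (maximalIdeal_le_comap_galAut σ)

/-- `residueGal σ (res a) = res (σ a)`. [folklore] -/
@[simp] theorem residueGal_residue (σ : absoluteGaloisGroup F) (a : maxUnramifiedCompletion F) :
    residueGal σ (IsLocalRing.residue _ a) = IsLocalRing.residue _ (maxUnramifiedCompletion.galAut F σ a) := rfl

/-! ### `p` in `𝒪̂_{F^nr}` -/

omit [Fact p.Prime] in
/-- `p = algebraMap 𝒪_F 𝒪̂_{F^nr} p`. [folklore] -/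
theorem natCast_completion_eq_algebraMap :
    (p : maxUnramifiedCompletion F) = algebraMap 𝒪[F] (maxUnramifiedCompletion F) (p : 𝒪[F]) :=
  (map_natCast _ p).symm

omit [Fact p.Prime] in
/-- **`p ∈ 𝔪̂`** (residue characteristic `p`). [folklore] -/
theorem natCast_mem_maximalIdeal_completion (hp : valuation F p < 1) :
    (p : maxUnramifiedCompletion F) ∈ maximalIdeal (maxUnramifiedCompletion F) := by
  rw [natCast_completion_eq_algebraMap, ← pow_one (maximalIdeal (maxUnramifiedCompletion F)),
    maxUnramifiedCompletion.algebraMap_mem_maximalIdeal_pow_iff, pow_one]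
  exact LocalField.natCast_mem_maximalIdeal hp

omit [Fact p.Prime] in
/-- **`p` is not a unit of `𝒪̂_{F^nr}`.** [folklore] -/
theorem not_isUnit_natCast_completion (hp : valuation F p < 1) : ¬ IsUnit (p : maxUnramifiedCompletion F) :=
  fun h => (IsLocalRing.mem_maximalIdeal _).mp (natCast_mem_maximalIdeal_completion hp) h

omit [Fact p.Prime] in
/-- `ι₀(p) = p` for the canonical `ι₀ : 𝒪̂_{F^nr} → 𝒪_{ℂ_F}`. [folklore] -/
theorem toCInt_natCast {ϖ : 𝒪[F]} (hϖ : Irreducible ϖ) : toCInt hϖ (p : maxUnramifiedCompletion F) = p :=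
  map_natCast _ p

omit [Fact p.Prime] in
/-- `p ≠ 0` in `𝒪̂_{F^nr}` (characteristic `0`). [folklore] -/
theorem natCast_completion_ne_zero [CharZero F] (hp0 : p ≠ 0) : (p : maxUnramifiedCompletion F) ≠ 0 := by
  intro h
  obtain ⟨ϖ, hϖ⟩ := exists_irreducible_integer (F := F)
  have := congrArg (toCInt hϖ) h
  rw [toCInt_natCast, map_zero] at this
  have h' : ((p : integerC F) : CompletedAlgClosure F) = 0 := by rw [this]; rfl
  rw [coe_natCast_integerC] at h'
  exact natCast_C_ne_zero hp0 h'

omit [Fact p.Prime] in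
/-- **`𝔪̂ ^ e = (p)`** for some `e` (the absolute ramification index of `F`): `p ≠ 0` lies in the
maximal ideal of the discrete valuation ring `𝒪̂_{F^nr}`. [cite: SerreLocalFields1979, Ch. II §5] -/
theorem exists_maximalIdeal_pow_eq_span_natCast [CharZero F] (hp0 : p ≠ 0) :
    ∃ e : ℕ, maximalIdeal (maxUnramifiedCompletion F) ^ e = Ideal.span {(p : maxUnramifiedCompletion F)} := by
  obtain ⟨ϖ, hϖ⟩ := IsDiscreteValuationRing.exists_irreducible (maxUnramifiedCompletion F)
  obtain ⟨e, u, hu⟩ := IsDiscreteValuationRing.associated_pow_irreducible (natCast_completion_ne_zero hp0) hϖ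
  refine ⟨e, ?_⟩
  rw [hϖ.maximalIdeal_eq, Ideal.span_singleton_pow, Ideal.span_singleton_eq_span_singleton]
  exact ⟨u⁻¹, by rw [← hu, mul_assoc, Units.mul_inv, mul_one]⟩

omit [Fact p.Prime] in
/-- **`𝒪̂_{F^nr}` is `p`-adically complete and separated** (its `𝔪̂`-adic and `p`-adic topologies
coincide). [cite: SerreLocalFields1979, Ch. II §5] -/
theorem isAdicComplete_span_natCast_completion [CharZero F] (hp : valuation F p < 1) (hp0 : p ≠ 0) :
    IsAdicComplete (Ideal.span {(p : maxUnramifiedCompletion F)}) (maxUnramifiedCompletion F) := by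
  obtain ⟨e, he⟩ := exists_maximalIdeal_pow_eq_span_natCast (F := F) hp0
  refine isAdicComplete_of_le_of_pow_le (I := maximalIdeal (maxUnramifiedCompletion F)) ?_ he.le
  rw [Ideal.span_le, Set.singleton_subset_iff]
  exact natCast_mem_maximalIdeal_completion hp

/-! ### The reduction `𝒪̂/p → k̄` and the tilt of `𝒪̂_{F^nr}` -/

section ModP

variable [Fact (¬ IsUnit (p : maxUnramifiedCompletion F))]

omit [Fact p.Prime] in
/-- `p ∈ 𝔪̂` (from the instance hypothesis `p ∉ 𝒪̂ˣ`). [folklore] -/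
theorem natCast_mem_maximalIdeal_completion' :
    (p : maxUnramifiedCompletion F) ∈ maximalIdeal (maxUnramifiedCompletion F) :=
  (IsLocalRing.mem_maximalIdeal _).mpr (Fact.out : ¬ IsUnit (p : maxUnramifiedCompletion F))

variable (F p) in
/-- **The reduction `𝒪̂_{F^nr}/p → k̄`** onto the residue field. [cite: SerreLocalFields1979, Ch. II §5] -/
def residueModP : ModP (maxUnramifiedCompletion F) p →+* ResidueField (maxUnramifiedCompletion F) :=
  Ideal.Quotient.lift (Ideal.span {(p : maxUnramifiedCompletion F)}) (IsLocalRing.residue (maxUnramifiedCompletion F))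
    fun a ha => by
      obtain ⟨b, hb⟩ := Ideal.mem_span_singleton.mp ha
      rw [hb, map_mul, (IsLocalRing.residue_eq_zero_iff (p : maxUnramifiedCompletion F)).mpr
        (natCast_mem_maximalIdeal_completion' (F := F) (p := p)), zero_mul]

omit [Fact p.Prime] in
/-- `residueModP` on residue classes. [folklore] -/
@[simp] theorem residueModP_mk (a : maxUnramifiedCompletion F) :
    residueModP F p (Ideal.Quotient.mk (Ideal.span {(p : maxUnramifiedCompletion F)}) a) =
      IsLocalRing.residue (maxUnramifiedCompletion F) a := rfl

omit [Fact p.Prime] in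
/-- `residueModP` is surjective. [folklore] -/
theorem residueModP_surjective : Function.Surjective (residueModP F p) := fun y => by
  obtain ⟨a, rfl⟩ := IsLocalRing.residue_surjective y
  exact ⟨Ideal.Quotient.mk _ a, rfl⟩

omit [Fact p.Prime] in
/-- `residueModP x = 0 ↔ x` comes from `𝔪̂`. [folklore] -/
theorem residueModP_mk_eq_zero_iff (a : maxUnramifiedCompletion F) :
    residueModP F p (Ideal.Quotient.mk (Ideal.span {(p : maxUnramifiedCompletion F)}) a) = 0 ↔
      a ∈ maximalIdeal (maxUnramifiedCompletion F) := by
  rw [residueModP_mk, IsLocalRing.residue_eq_zero_iff]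

/-- **The kernel of `𝒪̂/p → k̄` is nil of bounded exponent**: for some `m`, `residueModP x = 0`
implies `x ^ (p ^ m) = 0` (`𝔪̂ ^ e = (p)`). [cite: SerreLocalFields1979, Ch. II §5] -/
theorem exists_forall_residueModP_eq_zero_pow_eq_zero [CharZero F] :
    ∃ m : ℕ, ∀ x : ModP (maxUnramifiedCompletion F) p, residueModP F p x = 0 → x ^ p ^ m = 0 := by
  obtain ⟨e, he⟩ := exists_maximalIdeal_pow_eq_span_natCast (F := F) (Fact.out : p.Prime).ne_zero
  refine ⟨e, fun x hx => ?_⟩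
  obtain ⟨a, rfl⟩ := Ideal.Quotient.mk_surjective x
  rw [residueModP_mk_eq_zero_iff] at hx
  have hae : a ^ e ∈ Ideal.span {(p : maxUnramifiedCompletion F)} := he ▸ Ideal.pow_mem_pow hx e
  have h1 : (Ideal.Quotient.mk (Ideal.span {(p : maxUnramifiedCompletion F)}) a) ^ e = 0 := by
    rw [← map_pow, Ideal.Quotient.eq_zero_iff_mem]; exact hae
  exact pow_eq_zero_of_le (Nat.lt_pow_self (Fact.out : p.Prime).one_lt).le h1

variable (F p) in
/-- An exponent `m` with `ker (𝒪̂/p → k̄)` killed by `x ↦ x ^ (p ^ m)` (Hilbert's `ε`; an arbitrary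
value if no such exponent existed, which the hypotheses of its specification exclude). [folklore] -/
def nilExponent : ℕ :=
  Classical.epsilon fun m : ℕ => ∀ x : ModP (maxUnramifiedCompletion F) p, residueModP F p x = 0 → x ^ p ^ m = 0

/-- **Specification of `nilExponent`.** [cite: SerreLocalFields1979, Ch. II §5] -/
theorem pow_nilExponent [CharZero F] :
    ∀ x : ModP (maxUnramifiedCompletion F) p, residueModP F p x = 0 → x ^ p ^ nilExponent F p = 0 :=
  Classical.epsilon_spec (p := fun m : ℕ => ∀ x : ModP (maxUnramifiedCompletion F) p,
    residueModP F p x = 0 → x ^ p ^ m = 0) (exists_forall_residueModP_eq_zero_pow_eq_zero (F := F) (p := p))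

end ModP

/-! ### The residue field `k̄`: characteristic `p`, algebraically closed, perfect -/

/-- **`k̄ = ResidueField 𝒪̂_{F^nr}` is algebraically closed** (it is the residue field `S ⧸ 𝔓` of
`𝒪_{F̄}`, files `MaxUnramifiedIntegers`, `UnramifiedLang`). [cite: SerreLocalFields1979, Ch. IV §4 Cor. 2 to Prop. 16] -/
instance isAlgClosed_residueField_completion : IsAlgClosed (ResidueField (maxUnramifiedCompletion F)) := by
  haveI := isAlgClosed_quotient_absMaximalIdeal F
  haveI : Fact (absMaximalIdeal F).IsMaximal := ⟨absMaximalIdeal_isMaximal_holds F⟩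
  letI : Field (absIntegers 𝒪[F] F ⧸ absMaximalIdeal F) := Ideal.Quotient.field _
  exact IsAlgClosed.of_ringEquiv (absIntegers 𝒪[F] F ⧸ absMaximalIdeal F) (ResidueField (maxUnramifiedCompletion F))
    ((maxUnramifiedIntegers.residueFieldEquiv F).symm.trans (maxUnramifiedCompletion.residueFieldEquiv F))

/-- **`k̄` has characteristic `p`** (under `p ∉ 𝒪̂ˣ`, i.e. residue characteristic `p`).  Not an
instance (`p` is not determined by the ring); files below take `[CharP k̄ p]` as an instance argument
and discharge it with this theorem. [folklore] -/
theorem charP_residueField_completion [Fact (¬ IsUnit (p : maxUnramifiedCompletion F))] :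
    CharP (ResidueField (maxUnramifiedCompletion F)) p :=
  (CharP.charP_iff_prime_eq_zero Fact.out).mpr <| by
    rw [← map_natCast (IsLocalRing.residue (maxUnramifiedCompletion F)), IsLocalRing.residue_eq_zero_iff]
    exact natCast_mem_maximalIdeal_completion'

/-- `k̄` is a perfect ring of characteristic `p` (algebraically closed). [folklore] -/
theorem perfectRing_residueField_completion [CharP (ResidueField (maxUnramifiedCompletion F)) p] :
    PerfectRing (ResidueField (maxUnramifiedCompletion F)) p :=
  PerfectField.toPerfectRing p

section Tilt

variable [CharZero F] [Fact (¬ IsUnit (p : maxUnramifiedCompletion F))]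
  [CharP (ResidueField (maxUnramifiedCompletion F)) p]

/-- **The tilt of `𝒪̂_{F^nr}` is its residue field**: `k̄ ≃+* (𝒪̂_{F^nr})♭ = lim_{x ↦ x^p} 𝒪̂/p`
(file `TiltOfPerfectResidue`, for the nil-thickening `𝒪̂/p → k̄`).
[cite: SerreLocalFields1979, Ch. II §4 Prop. 8 and §5 Thm. 4] -/
def residueTiltEquiv (F : Type) [Field F] [ValuativeRel F] [TopologicalSpace F] [IsNonarchimedeanLocalField F]
    [CharZero F] (p : ℕ) [Fact p.Prime] [Fact (¬ IsUnit (p : maxUnramifiedCompletion F))]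
    [CharP (ResidueField (maxUnramifiedCompletion F)) p] :
    ResidueField (maxUnramifiedCompletion F) ≃+* PreTilt (maxUnramifiedCompletion F) p :=
  tiltEquivOfPerfectResidue (residueModP F p) residueModP_surjective (nilExponent F p) pow_nilExponent

/-- The inverse of `residueTiltEquiv` is "reduce the `0`-th component": `e⁻¹ x = res (x₀)`. [folklore] -/
theorem residueTiltEquiv_symm_apply (x : PreTilt (maxUnramifiedCompletion F) p) :
    (residueTiltEquiv F p).symm x = residueModP F p (PreTilt.coeff 0 x) :=
  tiltEquivOfPerfectResidue_symm_apply (O := maxUnramifiedCompletion F) residueModP_surjective pow_nilExponent x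

/-- `res (coeff 0 (e y)) = y`. [folklore] -/
theorem residueModP_coeff_zero_residueTiltEquiv (y : ResidueField (maxUnramifiedCompletion F)) :
    residueModP F p (PreTilt.coeff 0 (residueTiltEquiv F p y)) = y :=
  apply_coeff_zero_tiltEquivOfPerfectResidue (O := maxUnramifiedCompletion F) residueModP_surjective pow_nilExponent y

variable [IsAdicComplete (Ideal.span {(p : maxUnramifiedCompletion F)}) (maxUnramifiedCompletion F)]

/-- **`W(k̄) → 𝒪̂_{F^nr}`**, the embedding of Serre, *Local Fields* II §5 Thm. 4 (Fontaine's `θ` of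
`𝒪̂_{F^nr}` composed with `𝕎(k̄ ≃ (𝒪̂_{F^nr})♭)`). [cite: SerreLocalFields1979, Ch. II §5 Thm. 4] -/
def wittToCompletion (F : Type) [Field F] [ValuativeRel F] [TopologicalSpace F] [IsNonarchimedeanLocalField F]
    [CharZero F] (p : ℕ) [Fact p.Prime] [Fact (¬ IsUnit (p : maxUnramifiedCompletion F))]
    [CharP (ResidueField (maxUnramifiedCompletion F)) p]
    [IsAdicComplete (Ideal.span {(p : maxUnramifiedCompletion F)}) (maxUnramifiedCompletion F)] :
    WittVector p (ResidueField (maxUnramifiedCompletion F)) →+* maxUnramifiedCompletion F :=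
  wittToRingOfPerfectResidue (residueModP F p) residueModP_surjective (nilExponent F p) pow_nilExponent

/-- Unfolding: `wittToCompletion = θ_{𝒪̂} ∘ 𝕎(residueTiltEquiv)`. [folklore] -/
theorem wittToCompletion_apply (x : WittVector p (ResidueField (maxUnramifiedCompletion F))) :
    wittToCompletion F p x = fontaineTheta (maxUnramifiedCompletion F) p
      (WittVector.map (residueTiltEquiv F p).toRingHom x) := rfl

/-- **`W(k̄) → 𝒪̂_{F^nr}` induces the identity on residue fields**: `res (g x) = x₀`.
[cite: SerreLocalFields1979, Ch. II §5 Thm. 4] -/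
theorem residue_wittToCompletion (x : WittVector p (ResidueField (maxUnramifiedCompletion F))) :
    IsLocalRing.residue (maxUnramifiedCompletion F) (wittToCompletion F p x) = x.coeff 0 := by
  rw [← residueModP_mk (p := p)]
  exact apply_mk_wittToRingOfPerfectResidue (O := maxUnramifiedCompletion F) residueModP_surjective pow_nilExponent x

/-- `W(k̄) → 𝒪̂_{F^nr}` on Teichmüller representatives: `[y] ↦ (e y)♯`. [folklore] -/
theorem wittToCompletion_teichmuller (y : ResidueField (maxUnramifiedCompletion F)) :
    wittToCompletion F p (teichmuller p y) = PreTilt.untilt (residueTiltEquiv F p y) :=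
  wittToRingOfPerfectResidue_teichmuller (O := maxUnramifiedCompletion F) residueModP_surjective pow_nilExponent y

end Tilt

/-! ### The embedding `W(k̄) → 𝔸_inf(F)` -/

section Ainf

variable [CharZero F] [Fact (¬ IsUnit (p : maxUnramifiedCompletion F))]
  [CharP (ResidueField (maxUnramifiedCompletion F)) p] [Fact (¬ IsUnit (p : integerC F))]

variable (F) in
/-- The canonical `ι₀ : 𝒪̂_{F^nr} → 𝒪_{ℂ_F}` (`toCInt` for the chosen uniformiser of `toC`), so that
`(ι₀ x : ℂ_F) = toC x`. [folklore] -/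
def toCInt₀ : maxUnramifiedCompletion F →+* integerC F :=
  toCInt (exists_irreducible_integer (F := F)).choose_spec

omit [CharZero F] [Fact p.Prime] [Fact (¬ IsUnit (p : maxUnramifiedCompletion F))]
  [CharP (ResidueField (maxUnramifiedCompletion F)) p] [Fact (¬ IsUnit (p : integerC F))] in
/-- `(ι₀ x : ℂ_F) = ι x`. [folklore] -/
@[simp] theorem coe_toCInt₀ (x : maxUnramifiedCompletion F) :
    ((toCInt₀ F x : integerC F) : CompletedAlgClosure F) = maxUnramifiedCompletion.toC F x := rfl

omit [CharZero F] [Fact p.Prime] [Fact (¬ IsUnit (p : maxUnramifiedCompletion F))]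
  [CharP (ResidueField (maxUnramifiedCompletion F)) p] [Fact (¬ IsUnit (p : integerC F))] in
/-- `ι₀` is `Γ_F`-equivariant. [folklore] -/
theorem galInt_toCInt₀ (σ : absoluteGaloisGroup F) (x : maxUnramifiedCompletion F) :
    galInt σ (toCInt₀ F x) = toCInt₀ F (maxUnramifiedCompletion.galAut F σ x) :=
  galInt_toCInt _ σ x

/-- **`W(k̄) → 𝔸_inf(F)`**: Witt functoriality of `k̄ ≃ (𝒪̂_{F^nr})♭ → 𝒪_{ℂ_F}♭` (the tilt of `ι₀`).
[cite: FontaineAsterisque223III, Exp. II §1.2] -/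
def wittToAinf (F : Type) [Field F] [ValuativeRel F] [TopologicalSpace F] [IsNonarchimedeanLocalField F]
    [CharZero F] (p : ℕ) [Fact p.Prime] [Fact (¬ IsUnit (p : maxUnramifiedCompletion F))]
    [CharP (ResidueField (maxUnramifiedCompletion F)) p] [Fact (¬ IsUnit (p : integerC F))] :
    WittVector p (ResidueField (maxUnramifiedCompletion F)) →+* Ainf (p := p) F :=
  (WittVector.map (tiltMap p (toCInt₀ F))).comp (WittVector.map (residueTiltEquiv F p).toRingHom)

/-- Witt components of `wittToAinf x`. [folklore] -/
theorem coeff_wittToAinf (x : WittVector p (ResidueField (maxUnramifiedCompletion F))) (n : ℕ) :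
    (wittToAinf F p x).coeff n = tiltMap p (toCInt₀ F) (residueTiltEquiv F p (x.coeff n)) := by
  simp [wittToAinf, WittVector.map_coeff]

/-- `wittToAinf` on Teichmüller representatives. [folklore] -/
theorem wittToAinf_teichmuller (y : ResidueField (maxUnramifiedCompletion F)) :
    wittToAinf F p (teichmuller p y) = teichmuller p (tiltMap p (toCInt₀ F) (residueTiltEquiv F p y)) := by
  simp [wittToAinf, WittVector.map_teichmuller]

variable [IsAdicComplete (Ideal.span {(p : maxUnramifiedCompletion F)}) (maxUnramifiedCompletion F)]
  [IsAdicComplete (Ideal.span {(p : integerC F)}) (integerC F)]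

/-- **`θ ∘ (W(k̄) → 𝔸_inf) = ι₀ ∘ (W(k̄) → 𝒪̂_{F^nr})`**: Fontaine's `θ` restricted to `W(k̄)` is the
canonical embedding `W(k̄) ⊆ 𝒪̂_{F^nr} ⊆ 𝒪_{ℂ_F}` (naturality of `θ`, file `FontaineThetaNaturality`).
[cite: FontaineAsterisque223III, Exp. II §1.2] -/
theorem fontaineTheta_wittToAinf (x : WittVector p (ResidueField (maxUnramifiedCompletion F))) :
    fontaineTheta (integerC F) p (wittToAinf F p x) = toCInt₀ F (wittToCompletion F p x) := by
  rw [wittToAinf, RingHom.comp_apply, fontaineTheta_map_tiltMap, wittToCompletion_apply]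

/-- The same in `ℂ_F`: `θ (wittToAinf x) = ι (wittToCompletion x)`. [cite: FontaineAsterisque223III, Exp. II §1.2] -/
theorem coe_fontaineTheta_wittToAinf (x : WittVector p (ResidueField (maxUnramifiedCompletion F))) :
    ((fontaineTheta (integerC F) p (wittToAinf F p x) : integerC F) : CompletedAlgClosure F) =
      maxUnramifiedCompletion.toC F (wittToCompletion F p x) := by
  rw [fontaineTheta_wittToAinf, coe_toCInt₀]

/-! ### `Γ_F`-equivariance -/

omit [Fact (¬ IsUnit (p : integerC F))] [IsAdicComplete (Ideal.span {(p : integerC F)}) (integerC F)]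
  [IsAdicComplete (Ideal.span {(p : maxUnramifiedCompletion F)}) (maxUnramifiedCompletion F)] in
/-- **The tilt equivalence is `Γ_F`-equivariant**: `e (σ̄ y) = (galAut σ)♭ (e y)` — both ring maps
`k̄ → (𝒪̂_{F^nr})♭` become `σ̄` after composing with `e⁻¹ = res ∘ coeff 0`. [folklore] -/
theorem residueTiltEquiv_residueGal (σ : absoluteGaloisGroup F) (y : ResidueField (maxUnramifiedCompletion F)) :
    residueTiltEquiv F p (residueGal σ y) =
      tiltMap p (maxUnramifiedCompletion.galAut F σ).toRingHom (residueTiltEquiv F p y) := by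
  apply (residueTiltEquiv F p).symm.injective
  rw [RingEquiv.symm_apply_apply, residueTiltEquiv_symm_apply, coeff_tiltMap]
  -- `res (σ mod p (coeff 0 (e y))) = σ̄ (res (coeff 0 (e y))) = σ̄ y`
  obtain ⟨a, ha⟩ := Ideal.Quotient.mk_surjective (PreTilt.coeff 0 (residueTiltEquiv F p y))
  have hy : residueModP F p (PreTilt.coeff 0 (residueTiltEquiv F p y)) = y :=
    residueModP_coeff_zero_residueTiltEquiv y
  rw [← ha] at hy ⊢
  rw [modPMap_mk, residueModP_mk]
  rw [residueModP_mk] at hy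
  rw [← hy]
  rfl

omit [IsAdicComplete (Ideal.span {(p : maxUnramifiedCompletion F)}) (maxUnramifiedCompletion F)]
  [IsAdicComplete (Ideal.span {(p : integerC F)}) (integerC F)] in
/-- **`W(k̄) → 𝔸_inf(F)` is `Γ_F`-equivariant**: `𝕎(σ♭) (wittToAinf x) = wittToAinf (𝕎(σ̄) x)`.
[cite: FontaineAsterisque223III, Exp. II §1.2] -/
theorem galAinf_wittToAinf (σ : absoluteGaloisGroup F) (x : WittVector p (ResidueField (maxUnramifiedCompletion F))) :
    galAinf σ (wittToAinf F p x) = wittToAinf F p (WittVector.map (residueGal σ) x) := by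
  refine WittVector.ext fun n => ?_
  rw [coeff_galAinf, coeff_wittToAinf, coeff_wittToAinf, WittVector.map_coeff, residueTiltEquiv_residueGal]
  -- `σ♭ ∘ ι₀♭ = ι₀♭ ∘ (galAut σ)♭` by functoriality of the tilt and equivariance of `ι₀`
  change tiltMap p (galInt σ) (tiltMap p (toCInt₀ F) _) = _
  rw [← tiltMap_comp_apply, ← tiltMap_comp_apply]
  exact tiltMap_congr (fun z => galInt_toCInt₀ σ z) _

end Ainf

end Literature.NumberTheory.PAdicHodge

end
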